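import Summits.QuantumFields.YangMills.Theorems.BalabanLadderInfVolRPExpansion
import HarnessLib

/-!
# Infinite-volume reflection positivity, III: the lattice OS form of a `ℤ⁴` state IS its RP square (exact E2)

R136 (i) «infinite-volume ∕ continuum-from-UV» programme (director-ym), prover seat `ym-infvol-p3`, pre-birth
support filed `--supports` the spine leg `UV` (stmt-QuantumFields-19351) of `route-QuantumFields-BalabanLadder`.
HONEST FRAMING: conditional material for the EXISTENCE half (OS0–OS3 of a continuum limit); not a mass gap, not
Clay; NOTHING is asserted about Yang–Mills — statements about an arbitrary site-RP probability measure on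
`LGConfig 4 G` (which every torus limit point at `β ≥ 0` is, GaugeBoot `siteRP_zero_of_mem_infiniteVolumeLimitPoints`).

* `stateDist r μ a B o m n F = Σ_{Q valid} Σ_{z ∈ (box 4 B)ⁿ} F(a (z + o∘Q)) · W_μ(Q, m∘Q, z)` — the centred plane-string
  LATTICE DISTRIBUTION of the state `μ` at spacing `a` (summation box `B`, orientation offsets `o`, centrings `m`):
  the infinite-volume analogue of the spine's torus `latticeDistStr`/`latticeDist` summed over orientations;
* `centreOffset` — the plaquette-centre offsets `o q = (e_{q.1} + e_{q.2})/2` (valid `q`), with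
  `centreOffset_time` (time components in `[0, 1)`) and `two_mul_centreOffset_zero` (`2 (o q)₀ = [q.1 = 0]`);
* **`stateDist_osForm_eq_rpSquare`**: for centre-type offsets, a tuple `Fⱼ` with time supports in `(0, T]`,
  `T + a ≤ a B`, and witnesses `Hᵢⱼ` of `ΘFᵢ* ⊗ Fⱼ`, the lattice OS form `Σᵢⱼ stateDist (Hᵢⱼ)` EQUALS the RP square
  `∫ conj(Σ X(ΘU)) Σ X(U) dμ` of the smeared fields (files I–II; zero shift) — hence
  **`stateDist_osForm_nonneg`**: `0 ≤ Re`, `Im = 0` in every site-RP state: lattice E2 is EXACT at every spacing;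
  `stateDist_osForm_nonneg_smul`: the same for the renormalised distributions `c^n · stateDist n` (real `c`).

References: K. Osterwalder, E. Seiler, Ann. Phys. 110 (1978) 440, §2; K. Osterwalder, R. Schrader, CMP 31 (1973) §2 (E2).
-/

noncomputable section

open scoped SchwartzMap BigOperators ComplexConjugate
open MeasureTheory Filter Topology
open Literature.MathematicalPhysics.QuantumFieldTheory Literature.MathematicalPhysics.QuantumLattice
open Literature.Probability.LatticeModels (box Site mem_box)
open Summit.QuantumFields.GaugeBoot (configSiteReflect siteHalfEdges IsReflectionPositiveFor)
open Summit.QuantumFields.YangMills.Theorems.OSLegsFromFemtoAndGap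
  (sum_piFinset_append append_comp_eq mem_planeStrings_iff'')

namespace Summit.QuantumFields.YangMills.Theorems.InfVolRP

local notation "E4" => EuclideanSpace ℝ (Fin 4)

variable {G : Type} [Group G] [TopologicalSpace G] [IsTopologicalGroup G] [CompactSpace G]
  [MeasurableSpace G] [BorelSpace G]

/-! ### The lattice distribution of a state -/

/-- **Centred plane-string lattice distribution of the state `μ`** at spacing `a`, summation box `box 4 B`,
orientation offsets `o` and centrings `m`:
`stateDist n F = Σ_{Q valid} Σ_{z ∈ (box 4 B)ⁿ} F((a (z l + o (Q l)))_l) · ∫ ∏ₗ (plane (Q l) (z l) − m (Q l)) dμ`. -/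
def stateDist (r : LatticeRep G) (μ : Measure (LGConfig 4 G)) (a : ℝ) (B : ℕ) (o : Fin 4 × Fin 4 → E4)
    (m : Fin 4 × Fin 4 → ℝ) (n : ℕ) (F : 𝓢((Fin n → E4), ℂ)) : ℂ :=
  ∑ Q ∈ Fintype.piFinset (fun _ : Fin n => Finset.univ.filter fun pl : Fin 4 × Fin 4 => pl.1 < pl.2),
    ∑ z ∈ Fintype.piFinset (fun _ : Fin n => box 4 B),
      F (fun l => a • (siteToE (z l) + o (Q l))) * (strWeight r μ Q (fun l => m (Q l)) z : ℂ)

omit [IsTopologicalGroup G] [CompactSpace G] [BorelSpace G] in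
/-- `stateDist` is homogeneous in the test function. -/
theorem stateDist_smul (r : LatticeRep G) (μ : Measure (LGConfig 4 G)) (a : ℝ) (B : ℕ) (o : Fin 4 × Fin 4 → E4)
    (m : Fin 4 × Fin 4 → ℝ) (n : ℕ) (c : ℂ) (F : 𝓢((Fin n → E4), ℂ)) :
    stateDist r μ a B o m n (c • F) = c * stateDist r μ a B o m n F := by
  unfold stateDist
  simp only [smul_apply, smul_eq_mul, Finset.mul_sum, mul_assoc]

/-! ### Plaquette-centre offsets -/

/-- **Plaquette-centre offsets**: `o q = (e_{q.1} + e_{q.2})/2` for a valid orientation `q.1 < q.2`, and `0`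
otherwise (so that the time component lies in `[0, 1)` for every `q`). -/
def centreOffset (q : Fin 4 × Fin 4) : E4 :=
  if q.1 < q.2 then (1 / 2 : ℝ) • (EuclideanSpace.single q.1 (1 : ℝ) + EuclideanSpace.single q.2 (1 : ℝ)) else 0

/-- Time component of the centre offsets: `[q.1 = 0]/2` for valid `q`, `0` otherwise. -/
theorem centreOffset_apply_zero (q : Fin 4 × Fin 4) :
    centreOffset q 0 = if q.1 < q.2 then (if q.1 = 0 then 1 / 2 else 0) else 0 := by
  unfold centreOffset
  by_cases hq : q.1 < q.2
  · have h2 : q.2 ≠ 0 := fun h => by rw [h] at hq; exact (Fin.not_lt_zero _) hq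
    rw [if_pos hq, if_pos hq]
    have h2' : (EuclideanSpace.single q.2 (1 : ℝ) : E4) 0 = 0 := PiLp.single_eq_of_ne' (p := 2) h2 _
    have h1' : (EuclideanSpace.single q.1 (1 : ℝ) : E4) 0 = if q.1 = 0 then 1 else 0 := by
      split_ifs with h1
      · rw [h1]; exact PiLp.single_eq_same (p := 2) _ _
      · exact PiLp.single_eq_of_ne' (p := 2) h1 _
    rw [PiLp.smul_apply, PiLp.add_apply, h2', h1', smul_eq_mul, add_zero]
    split_ifs <;> norm_num
  · rw [if_neg hq, if_neg hq]; rfl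

/-- The centre offsets have time components in `[0, 1)`. -/
theorem centreOffset_time (q : Fin 4 × Fin 4) : 0 ≤ centreOffset q 0 ∧ centreOffset q 0 < 1 := by
  rw [centreOffset_apply_zero]
  split_ifs <;> norm_num

/-- The centre offsets are of centre type: `2 (o q)₀ = [q.1 = 0]` for valid `q`. -/
theorem two_mul_centreOffset_zero {q : Fin 4 × Fin 4} (hq : q.1 < q.2) :
    2 * centreOffset q 0 = if q.1 = 0 then 1 else 0 := by
  rw [centreOffset_apply_zero, if_pos hq]
  split_ifs <;> norm_num

/-! ### The lattice OS form is the RP square -/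

/-- A test function with time support in `(0, T]` vanishes whenever some argument has time `≤ 0`. -/
theorem vanish_of_timeSupport {n : ℕ} {T : ℝ} {F : 𝓢((Fin n → E4), ℂ)}
    (hF : ∀ u : Fin n → E4, (∃ l, u l 0 ≤ 0 ∨ T < u l 0) → F u = 0) :
    ∀ u : Fin n → E4, (∃ l, u l 0 ≤ 0) → F u = 0 :=
  fun u ⟨l, hl⟩ => hF u ⟨l, Or.inl hl⟩

omit [IsTopologicalGroup G] [CompactSpace G] [BorelSpace G] in
/-- **One pair**: for centre-type offsets and `Fᵢ` with time support in `(0, T]`, `T + a ≤ a B`, the lattice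
distribution of a witness `H` of `ΘFᵢ* ⊗ Fⱼ` is the `(i, j)` term of the expanded RP square
(`integral_rpSquare_eq`), via `rpTerm_eq_shifted` with zero shift and the splitting of appended sums. -/
theorem stateDist_appendTensor_eq_rpTerm (r : LatticeRep G) (μ : Measure (LGConfig 4 G)) {a T : ℝ} (ha : 0 < a)
    {B : ℕ} (hTB : T + a ≤ a * B) {o : Fin 4 × Fin 4 → E4} (ho : ∀ q, 0 ≤ o q 0 ∧ o q 0 < 1)
    (hoc : ∀ q : Fin 4 × Fin 4, q.1 < q.2 → 2 * o q 0 = if q.1 = 0 then 1 else 0) (m : Fin 4 × Fin 4 → ℝ)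
    {n k : ℕ} (Fi : 𝓢((Fin n → E4), ℂ)) (hFi : ∀ u : Fin n → E4, (∃ l, u l 0 ≤ 0 ∨ T < u l 0) → Fi u = 0)
    (Fj : 𝓢((Fin k → E4), ℂ)) (H : 𝓢((Fin (n + k) → E4), ℂ)) (hH : IsAppendTensorOf H (osAdjoint Fi) Fj) :
    stateDist r μ a B o m (n + k) H =
      ∑ q ∈ Fintype.piFinset (fun _ : Fin n => Finset.univ.filter fun pl : Fin 4 × Fin 4 => pl.1 < pl.2),
      ∑ p ∈ Fintype.piFinset (fun _ : Fin k => Finset.univ.filter fun pl : Fin 4 × Fin 4 => pl.1 < pl.2),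
      ∑ x ∈ Fintype.piFinset (fun _ : Fin n => box 4 B),
      ∑ y ∈ Fintype.piFinset (fun _ : Fin k => box 4 B),
        conj (Fi (fun l => a • (siteToE (x l) + o (q l)))) * Fj (fun l => a • (siteToE (y l) + o (p l))) *
          (strWeight r μ (Fin.append q p) (Fin.append (fun l => m (q l)) (fun l => m (p l)))
            (Fin.append (fun l => reflSite (q l) (x l)) y) : ℂ) := by
  classical
  rw [rpTerm_eq_shifted r μ ha hTB ho Fi hFi Fj m]
  unfold stateDist
  rw [sum_piFinset_append]
  refine Finset.sum_congr rfl fun q hq => Finset.sum_congr rfl fun p _ => ?_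
  rw [sum_piFinset_append]
  refine Finset.sum_congr rfl fun x _ => Finset.sum_congr rfl fun y _ => ?_
  have hqv : ∀ l, (q l).1 < (q l).2 := (mem_planeStrings_iff'' q).1 hq
  -- the witness at the appended points
  rw [hH, osAdjoint_apply, ← append_comp_eq m q p]
  have hpt1 : (fun i => timeReflection 4
        (((fun l => a • (siteToE (Fin.append x y l) + o (Fin.append q p l))) ∘ Fin.castAdd k) (Fin.rev i))) =
      fun l => timeReflection 4 (a • (siteToE (x (Fin.rev l)) + o (q (Fin.rev l)))) +
        (a * (2 * o (q (Fin.rev l)) 0 - if (q (Fin.rev l)).1 = 0 then 1 else 0)) •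
          EuclideanSpace.single (0 : Fin 4) (1 : ℝ) := by
    funext l
    simp only [Function.comp_apply, Fin.append_left]
    rw [hoc _ (hqv _), sub_self, mul_zero, zero_smul, add_zero]
  have hpt2 : ((fun l => a • (siteToE (Fin.append x y l) + o (Fin.append q p l))) ∘ Fin.natAdd n) =
      fun l => a • (siteToE (y l) + o (p l)) := by
    funext l
    simp only [Function.comp_apply, Fin.append_right]
  rw [hpt1, hpt2]

/-- **The lattice OS form IS the RP square** (centre-type offsets): for a tuple `Fⱼ` with time supports in `(0, T]`,
`T + a ≤ a B`, and witnesses `Hᵢⱼ` of `ΘFᵢ* ⊗ Fⱼ`,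
`Σᵢⱼ stateDist (deg i + deg j) Hᵢⱼ = ∫ conj(Σⱼ Xⱼ(ΘU)) · Σⱼ Xⱼ(U) dμ` with `Xⱼ = fieldObs a B o Fⱼ m`. -/
theorem stateDist_osForm_eq_rpSquare [SecondCountableTopology G] (r : LatticeRep G) (μ : Measure (LGConfig 4 G))
    [IsFiniteMeasure μ] {a T : ℝ} (ha : 0 < a) {B : ℕ} (hTB : T + a ≤ a * B) {o : Fin 4 × Fin 4 → E4}
    (ho : ∀ q, 0 ≤ o q 0 ∧ o q 0 < 1) (hoc : ∀ q : Fin 4 × Fin 4, q.1 < q.2 → 2 * o q 0 = if q.1 = 0 then 1 else 0)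
    (m : Fin 4 × Fin 4 → ℝ) {N : ℕ} {deg : Fin N → ℕ} (F : (j : Fin N) → 𝓢((Fin (deg j) → E4), ℂ))
    (hF : ∀ j (u : Fin (deg j) → E4), (∃ l, u l 0 ≤ 0 ∨ T < u l 0) → F j u = 0)
    (H : (i j : Fin N) → 𝓢((Fin (deg i + deg j) → E4), ℂ))
    (hH : ∀ i j, IsAppendTensorOf (H i j) (osAdjoint (F i)) (F j)) :
    ∑ i, ∑ j, stateDist r μ a B o m (deg i + deg j) (H i j) =
      ∫ U, conj (∑ j, fieldObs r a B o (F j) m (cfgReflect U)) * ∑ j, fieldObs r a B o (F j) m U ∂μ := by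
  rw [integral_rpSquare_eq]
  exact Finset.sum_congr rfl fun i _ => Finset.sum_congr rfl fun j _ =>
    stateDist_appendTensor_eq_rpTerm r μ ha hTB ho hoc m (F i) (hF i) (F j) (H i j) (hH i j)

/-- **Exact lattice E2 in infinite volume.** In every site-RP state `μ` of the infinite lattice (GaugeBoot
`IsReflectionPositiveFor (configSiteReflect 0) (siteHalfEdges 0) μ` — e.g. every torus limit point at `β ≥ 0`), at
every spacing `a > 0`, with centre-type offsets: for every finite tuple of test functions `Fⱼ` with time supports in
`(0, T]`, `T + a ≤ a B`, and witnesses `Hᵢⱼ` of `ΘFᵢ* ⊗ Fⱼ`, the lattice OS form `z = Σᵢⱼ stateDist Hᵢⱼ` has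
`0 ≤ Re z` and `Im z = 0`.  No moment bound and no shift defect enter. -/
theorem stateDist_osForm_nonneg [SecondCountableTopology G] (r : LatticeRep G) {μ : Measure (LGConfig 4 G)}
    [IsFiniteMeasure μ] (hμ : IsReflectionPositiveFor (configSiteReflect (G := G) 0) (siteHalfEdges 0) μ)
    {a T : ℝ} (ha : 0 < a) {B : ℕ} (hTB : T + a ≤ a * B) {o : Fin 4 × Fin 4 → E4}
    (ho : ∀ q, 0 ≤ o q 0 ∧ o q 0 < 1) (hoc : ∀ q : Fin 4 × Fin 4, q.1 < q.2 → 2 * o q 0 = if q.1 = 0 then 1 else 0)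
    (m : Fin 4 × Fin 4 → ℝ) {N : ℕ} {deg : Fin N → ℕ} (F : (j : Fin N) → 𝓢((Fin (deg j) → E4), ℂ))
    (hF : ∀ j (u : Fin (deg j) → E4), (∃ l, u l 0 ≤ 0 ∨ T < u l 0) → F j u = 0)
    (H : (i j : Fin N) → 𝓢((Fin (deg i + deg j) → E4), ℂ))
    (hH : ∀ i j, IsAppendTensorOf (H i j) (osAdjoint (F i)) (F j)) :
    let z := ∑ i, ∑ j, stateDist r μ a B o m (deg i + deg j) (H i j)
    0 ≤ z.re ∧ z.im = 0 := by
  intro z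
  have hz : z = ∫ U, conj (∑ j, fieldObs r a B o (F j) m (cfgReflect U)) * ∑ j, fieldObs r a B o (F j) m U ∂μ :=
    stateDist_osForm_eq_rpSquare r μ ha hTB ho hoc m F hF H hH
  rw [hz]
  exact rpSquare_fieldObs_nonneg r hμ ha B ho F (fun j => vanish_of_timeSupport (hF j)) m

/-- **Exact lattice E2 for the renormalised distributions** `c^n · stateDist n` (any real `c`, e.g. `c = a⁻⁴`): the
renormalisation is absorbed into the test functions `c^{deg j} Fⱼ` (`conj (c^{deg i}) = c^{deg i}`). -/
theorem stateDist_osForm_nonneg_smul [SecondCountableTopology G] (r : LatticeRep G) {μ : Measure (LGConfig 4 G)}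
    [IsFiniteMeasure μ] (hμ : IsReflectionPositiveFor (configSiteReflect (G := G) 0) (siteHalfEdges 0) μ)
    {a T : ℝ} (ha : 0 < a) {B : ℕ} (hTB : T + a ≤ a * B) {o : Fin 4 × Fin 4 → E4}
    (ho : ∀ q, 0 ≤ o q 0 ∧ o q 0 < 1) (hoc : ∀ q : Fin 4 × Fin 4, q.1 < q.2 → 2 * o q 0 = if q.1 = 0 then 1 else 0)
    (m : Fin 4 × Fin 4 → ℝ) (c : ℝ) {N : ℕ} {deg : Fin N → ℕ}
    (F : (j : Fin N) → 𝓢((Fin (deg j) → E4), ℂ))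
    (hF : ∀ j (u : Fin (deg j) → E4), (∃ l, u l 0 ≤ 0 ∨ T < u l 0) → F j u = 0)
    (H : (i j : Fin N) → 𝓢((Fin (deg i + deg j) → E4), ℂ))
    (hH : ∀ i j, IsAppendTensorOf (H i j) (osAdjoint (F i)) (F j)) :
    let z := ∑ i, ∑ j, (c : ℂ) ^ (deg i + deg j) * stateDist r μ a B o m (deg i + deg j) (H i j)
    0 ≤ z.re ∧ z.im = 0 := by
  intro z
  -- absorb the constants into the test functions
  have key := stateDist_osForm_nonneg r hμ ha hTB ho hoc m (fun j => ((c : ℂ) ^ deg j) • F j)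
    (fun j u hu => by rw [smul_apply, hF j u hu, smul_zero])
    (fun i j => ((c : ℂ) ^ (deg i + deg j)) • H i j)
    (fun i j u => by
      rw [smul_apply, hH i j u, smul_apply, osAdjoint_apply, osAdjoint_apply, smul_apply,
        smul_eq_mul, smul_eq_mul, smul_eq_mul, map_mul, map_pow, Complex.conj_ofReal, pow_add]
      ring)
  have hz : z = ∑ i, ∑ j, stateDist r μ a B o m (deg i + deg j) (((c : ℂ) ^ (deg i + deg j)) • H i j) := by
    simp only [z, stateDist_smul]
  rw [hz]
  exact key

end Summit.QuantumFields.YangMills.Theorems.InfVolRP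

end
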